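import Summits.BirchSwinnertonDyer.BirchSwinnertonDyer.Theorems.AlignedTransportAtTwoMainConjectureOfRankZeroBSDAtTwoSexticNormRelationDescentSignFreeMu
import HarnessLib

/-!
# Route `AlignedTransportAtTwo`, crux C2 `MainConjectureOfRankZeroBSDAtTwo` (stmt-BirchSwinnertonDyer-22298):
# THE `S₃` NORM-RELATION DESCENT AT `p = 2`, SIGN-FREE — part D: the `λ`-INEQUALITY `λ₂(ℚ(W[2])) ≤ Σ_j λ₂(ℚ(β_j)) + λ₂(ℚ(√Δ_W))`

Sequel of `…SexticNormRelationDescentSignFree{,Mu}` (same seat bsd-line-att-p4 g29). HONEST FRAMING: WIDTH-5 attached prover seat on line `birth` of the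
lead `bsd-line-att-p2`; `--supports` stmt-BirchSwinnertonDyer-22298, closes nothing; BSD is NOT proved; crux C2, its verdict «blocked-on
`Rank1Residual.GreenbergMuConjectureIrreducible`» and every registered stub untouched. THEOREMS ONLY.

WHAT. `W/ℚ` elliptic, no rational `2`-torsion abscissa, `Δ_W ∉ ℚ²`, `2Δ_W ∉ ℚ²` (both signs); `κ_T, κ_j, κ_δ` cyclotomic `ℤ₂`-extensions of `T = ℚ(W[2])`,
`ℚ(β_j)`, `ℚ(δ)`. If `μ₂ = 0` (growth form) for the three cubic towers and the resolvent tower, then `μ₂(T) = 0` (part B) and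

  ★ `classicalLambda_divisionField_two_le_sum`: **`λ₂(T) ≤ λ₂(ℚ(β₀)) + λ₂(ℚ(β₁)) + λ₂(ℚ(β₂)) + λ₂(ℚ(δ))`**

— the slopes of the growth laws `e_n = λ n + ν` inherit part B's layer inequality `e_n(T) ≤ Σ_j e_n(ℚ(β_j)) + e_n(ℚ(δ))` (Iwasawa 1973 §3-type
`λ`-comparison, here DOWNWARD along the `S₃` relation; the upward half `λ₂(ℚ(δ)) ≤ λ₂(T)` is att-p3 g29's `classicalLambda_divisionField_two_modEq_two_resolvent`).
With a single cubic `λ` (the three cubic fields are conjugate) this reads `λ₂(ℚ(W[2])) ≤ 3λ₂(ℚ(β)) + λ₂(ℚ(√Δ_W))`. Nothing closed.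

References: [Iwasawa1973MuInvariants] §3; [BiasseEtAl2022] Prop. 3.7; [Washington1997] §13.3 Thm. 13.13; tree: parts A–B, `ClassicalLambdaInvariant`.
-/

set_option linter.dupNamespace false
set_option autoImplicit false

noncomputable section

open scoped Classical NumberField

namespace Summit.BirchSwinnertonDyer.BirchSwinnertonDyer.Theorems.AlignedTransportAtTwoSexticNormRelationDescentSignFreeLambda

open NumberField Polynomial WeierstrassCurve IntermediateField Field
  Literature.NumberTheory.EllipticCurves Literature.NumberTheory.EllipticCurves.Greenberg1999
  Literature.NumberTheory.EllipticCurves.DokchitserDokchitser2012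
  Literature.NumberTheory.EllipticCurves.ZpExtension Literature.NumberTheory.GaloisRepresentations
  Literature.NumberTheory.IwasawaTheory Literature.NumberTheory.NumberFields
  Summit.BirchSwinnertonDyer.BirchSwinnertonDyer.Theorems.AlignedTransportAtTwoFineRoad.DivisionCubic
  Summit.BirchSwinnertonDyer.BirchSwinnertonDyer.Theorems.AlignedTransportAtTwoSexticNormRelationDescent
  Summit.BirchSwinnertonDyer.BirchSwinnertonDyer.Theorems.AlignedTransportAtTwoSexticNormRelationDescentMu
  Summit.BirchSwinnertonDyer.BirchSwinnertonDyer.Theorems.AlignedTransportAtTwoSexticNormRelationDescentSignFree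
  Summit.BirchSwinnertonDyer.BirchSwinnertonDyer.Theorems.AlignedTransportAtTwoSexticNormRelationDescentSignFreeMu

variable (W : WeierstrassCurve ℚ) [W.IsElliptic]

omit [W.IsElliptic] in
/-- Slopes of eventually-compared affine functions: if `a·n + b ≤ c·n + d` for all `n ≥ n₀` (`a c : ℕ`, `b d : ℤ`) then `a ≤ c`. [folklore] -/
theorem nat_le_of_forall_affine_le {a c : ℕ} {b d : ℤ} {n₀ : ℕ} (h : ∀ n : ℕ, n₀ ≤ n → (a : ℤ) * n + b ≤ (c : ℤ) * n + d) : a ≤ c := by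
  by_contra hac'
  have hac : c < a := not_le.mp hac'
  -- take `n` large: `n ≥ n₀` and `n > d - b`
  set n : ℕ := max n₀ (d - b).toNat + 1 with hn
  have hn₀ : n₀ ≤ n := le_trans (le_max_left _ _) (Nat.le_succ _)
  have hnd : d - b < (n : ℤ) := by
    have h1 : (d - b).toNat ≤ max n₀ (d - b).toNat := le_max_right _ _
    have h2 : d - b ≤ ((d - b).toNat : ℤ) := Int.self_le_toNat (d - b)
    omega
  have key := h n hn₀
  have hca : (c : ℤ) + 1 ≤ (a : ℤ) := by exact_mod_cast hac
  nlinarith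

/-- ★ **THE `λ`-INEQUALITY OF THE `S₃` DESCENT, BOTH SIGNS OF `Δ_W`.** `W/ℚ` elliptic, no rational `2`-torsion abscissa, `Δ_W ∉ ℚ²`, `2Δ_W ∉ ℚ²`;
`κ_T, κ_j, κ_δ` cyclotomic `ℤ₂`-extensions of `ℚ(W[2])`, `ℚ(β_j)`, `ℚ(δ)` with `μ₂ = 0` (growth form) on the cubic and resolvent towers. Then `μ₂(ℚ(W[2])) = 0`
and **`λ₂(ℚ(W[2])) ≤ Σ_j λ₂(ℚ(β_j)) + λ₂(ℚ(δ))`** (`classicalLambda` = the slope of `e_n = λ n + ν`, `n ≫ 0`; part B's layer inequality passed to slopes).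
[cite: Iwasawa1973MuInvariants, §3] [cite: BiasseEtAl2022, Prop. 3.7] [cite: Washington1997, §13.3 Thm. 13.13] -/
theorem classicalLambda_divisionField_two_le_sum (ht : ∀ x : ℚ, ¬ HasRationalTwoTorsionX W x) (hsq : ¬ IsSquare W.Δ) (h2Δ : ¬ IsSquare (2 * W.Δ))
    (κK : (j : Fin 3) → ZpExtension ↥ℚ⟮xT W two_ne_zero j⟯ 2) (hκK : ∀ j, (κK j).IsCyclotomic) (hμK : ∀ j, ClassicalMuVanishes (κK j))
    (κk : ZpExtension ↥ℚ⟮4 * delta W two_ne_zero⟯ 2) (hκk : κk.IsCyclotomic) (hμk : ClassicalMuVanishes κk)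
    (κT : ZpExtension (W.divisionField 2) 2) (hκT : κT.IsCyclotomic) :
    ClassicalMuVanishes κT ∧ classicalLambda κT ≤ (∑ j : Fin 3, classicalLambda (κK j)) + classicalLambda κk := by
  -- `μ₂(T) = 0`: part B's `μ`-form (its tower hypotheses follow from `hμK`, `hμk` by independence of the normalisation)
  have hK : ∀ j : Fin 3, ∀ κj : ZpExtension ↥ℚ⟮xT W two_ne_zero j⟯ 2, κj.IsCyclotomic → ClassicalMuVanishes κj :=
    fun j κj hκj ↦ (classicalMuVanishes_iff_of_isCyclotomic _ _ (hκK j) hκj).mp (hμK j)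
  have hk : ∀ κ : ZpExtension ↥ℚ⟮4 * delta W two_ne_zero⟯ 2, κ.IsCyclotomic → ClassicalMuVanishes κ :=
    fun κ hκ ↦ (classicalMuVanishes_iff_of_isCyclotomic _ _ hκk hκ).mp hμk
  have hμT : ClassicalMuVanishes κT :=
    classicalMuVanishes_divisionField_two_of_cubic_of_resolvent_of_not_isSquare W ht hsq h2Δ hK hk κT hκT
  refine ⟨hμT, ?_⟩
  -- growth laws
  obtain ⟨νT, nT, hT⟩ := classicalLambda_spec κT hμT
  obtain ⟨ν0, n0, h0⟩ := classicalLambda_spec (κK 0) (hμK 0)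
  obtain ⟨ν1, n1, h1⟩ := classicalLambda_spec (κK 1) (hμK 1)
  obtain ⟨ν2, n2, h2⟩ := classicalLambda_spec (κK 2) (hμK 2)
  obtain ⟨νk, nk, hkk⟩ := classicalLambda_spec κk hμk
  rw [Fin.sum_univ_three]
  refine nat_le_of_forall_affine_le (b := νT) (d := ν0 + ν1 + ν2 + νk) (n₀ := max (max (max nT n0) (max n1 n2)) nk) fun n hn ↦ ?_
  have hnT : nT ≤ n := le_trans (le_trans (le_max_left _ _) (le_max_left _ _)) (le_trans (le_max_left _ _) hn)
  have hn0 : n0 ≤ n := le_trans (le_trans (le_max_right _ _) (le_max_left _ _)) (le_trans (le_max_left _ _) hn)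
  have hn1 : n1 ≤ n := le_trans (le_trans (le_max_left _ _) (le_max_right _ _)) (le_trans (le_max_left _ _) hn)
  have hn2 : n2 ≤ n := le_trans (le_trans (le_max_right _ _) (le_max_right _ _)) (le_trans (le_max_left _ _) hn)
  have hnk : nk ≤ n := le_trans (le_max_right _ _) hn
  have hle := classNumberPExp_divisionField_two_le_sum W ht hsq h2Δ κK hκK κk hκk κT hκT n
  rw [Fin.sum_univ_three] at hle
  have hle' : (classNumberPExp κT n : ℤ) ≤
      (classNumberPExp (κK 0) n : ℤ) + classNumberPExp (κK 1) n + classNumberPExp (κK 2) n + classNumberPExp κk n := by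
    exact_mod_cast hle
  rw [hT n hnT, h0 n hn0, h1 n hn1, h2 n hn2, hkk n hnk] at hle'
  push_cast
  linarith

/-- **With `2`-class-number-free cubic towers: `λ₂(ℚ(W[2])) ≤ λ₂(ℚ(√Δ_W))`** — and in fact `=` by part B's exactness; recorded in the slope currency for
consumers holding only `μ/λ` data of the resolvent. [cite: Iwasawa1973MuInvariants, §3] [cite: Washington1997, §13.3 Thm. 13.13] -/
theorem classicalLambda_divisionField_two_le_resolvent_of_cubic (ht : ∀ x : ℚ, ¬ HasRationalTwoTorsionX W x) (hsq : ¬ IsSquare W.Δ)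
    (h2Δ : ¬ IsSquare (2 * W.Δ))
    (hK : ∀ j : Fin 3, ∀ κj : ZpExtension ↥ℚ⟮xT W two_ne_zero j⟯ 2, κj.IsCyclotomic → ∀ n, classNumberPExp κj n = 0)
    (κk : ZpExtension ↥ℚ⟮4 * delta W two_ne_zero⟯ 2) (hκk : κk.IsCyclotomic) (hμk : ClassicalMuVanishes κk)
    (κT : ZpExtension (W.divisionField 2) 2) (hκT : κT.IsCyclotomic) :
    ClassicalMuVanishes κT ∧ classicalLambda κT ≤ classicalLambda κk := by
  refine ⟨(classicalMuVanishes_divisionField_two_iff_resolvent_of_cubic W ht hsq h2Δ hK κk hκk κT hκT).mpr hμk, ?_⟩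
  rw [classicalLambda_divisionField_two_eq_resolvent_of_cubic W ht hsq h2Δ hK κk hκk κT hκT]

end Summit.BirchSwinnertonDyer.BirchSwinnertonDyer.Theorems.AlignedTransportAtTwoSexticNormRelationDescentSignFreeLambda

end
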